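import Summits.AtomisticToContinuum.FouriersLaw.Theses.PuiseuxTransferLedger
import Summits.AtomisticToContinuum.FouriersLaw.Theorems.PuiseuxTransferLedgerExponentialLedgerGlue

/-!
# `ExponentiallyAffineResistance` from far-contact decoupling (support for stmt-AtomisticToContinuum-12115)

Conditional assembly of the BY-PRODUCT item `ExponentiallyAffineResistance` of route
`PuiseuxTransferLedger` in the route's vocabulary: the six hypotheses of the deciding theorem
`closes` (`PositiveConductance`, `FiniteResponseProfile`, `ContactIdentity`, `SeriesLedgerGlue`,
`TwoModeBulk`, `NonBallistic`) plus ONE further statement — far-contact decoupling of the local bond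
resistances `r_N(i) = (θ_N(i) - θ_N(i+1))/(D_N/(N-1))`, the layer-2 statement foreseen in the route
header ("the FarContactDecoupling statement … that upgrades the ledger to
ExponentiallyAffineResistance"), stated INLINE here (it is not a filed item; filing it is the
planner's call) — imply `ExponentiallyAffineResistance` with contact resistance `ρ = 2/γ + ρ∞`.
The real-analysis kernel is `exponentialLedgerGlue` (companion file
`PuiseuxTransferLedgerExponentialLedgerGlue.lean`); the series ledger `(N-1)/D_N = 2/γ + Σ_i r_N(i)`
is obtained from the contact rows and telescoping exactly as in `closes`.
-/

namespace Summit.AtomisticToContinuum.FouriersLaw.Theorems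

open MeasureTheory Filter Topology Finset
open Summit.AtomisticToContinuum.FouriersLaw.Theses.PuiseuxTransferLedger
open Literature.MathematicalPhysics.KineticTheory.HeatConduction

/-- **Conditional assembly of the by-product.** The six hypotheses of the route's `closes`
(`PositiveConductance`, `FiniteResponseProfile`, `ContactIdentity`, `SeriesLedgerGlue`,
`TwoModeBulk`, `NonBallistic`) together with FAR-CONTACT DECOUPLING of the local bond resistances
`r_N(i) = (θ_N(i) - θ_N(i+1))/(D_N/(N-1))` — comparing the `N`- and the `(N+1)`-chain along the same
steady-state family: `|r_N(i) - r_{N+1}(i)| ≤ C θ^(N-2-i)` (bonds at the same distance from the left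
contact differ by an amount exponentially small in their distance to the RIGHT contact) and
`|r_N(i) - r_{N+1}(i+1)| ≤ C θ^i` (same from the right) — imply `ExponentiallyAffineResistance`
with contact resistance `ρ = 2/γ + ρ∞`: the series ledger `(N-1)/D_N = 2/γ + Σ_i r_N(i)`
(contact rows + telescoping, as in `closes`) is fed to `exponentialLedgerGlue`, and `r > 0` comes
from `SeriesLedgerGlue` with `NonBallistic`. The decoupling hypothesis is stated inline (layer-2
statement foreseen by the route, not a filed item). [folklore] -/
theorem exponentiallyAffineResistance_of_farContactDecoupling
    (hPC : PositiveConductance) (hFP : FiniteResponseProfile) (hCI : ContactIdentity)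
    (hSL : SeriesLedgerGlue) (hTM : TwoModeBulk) (hNB : NonBallistic)
    (hFCD : ∀ ω₂ lam β γ : ℝ, 0 < ω₂ → 0 < lam → 0 < β → 0 < γ →
      (∀ (N : ℕ) (T_L T_R : ℝ), 0 < T_L → 0 < T_R →
        ∀ μ ν : Measure (PhaseSpace N), (pinnedChain ω₂ lam β γ).IsSteadyState N T_L T_R μ →
          (pinnedChain ω₂ lam β γ).IsSteadyState N T_L T_R ν → μ = ν) →
      ∀ μ : (N : ℕ) → ℝ → ℝ → Measure (PhaseSpace N),
        (∀ (N : ℕ) (T_L T_R : ℝ), 0 < T_L → 0 < T_R →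
          (pinnedChain ω₂ lam β γ).IsSteadyState N T_L T_R (μ N T_L T_R)) →
        ∀ T : ℝ, 0 < T → ∃ θ C : ℝ, 0 ≤ θ ∧ θ < 1 ∧
          ∀ (N : ℕ) (d d' : ℝ) (t : Fin N → ℝ) (t' : Fin (N + 1) → ℝ),
            Tendsto (fun δ : ℝ =>
              (pinnedChain ω₂ lam β γ).totalCurrent (μ N (T + δ / 2) (T - δ / 2)) / δ)
              (𝓝[≠] 0) (𝓝 d) →
            Tendsto (fun δ : ℝ =>
              (pinnedChain ω₂ lam β γ).totalCurrent (μ (N + 1) (T + δ / 2) (T - δ / 2)) / δ)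
              (𝓝[≠] 0) (𝓝 d') →
            (∀ i : Fin N, Tendsto (fun δ : ℝ =>
              ((∫ x, (x.2 i) ^ 2 ∂(μ N (T + δ / 2) (T - δ / 2))) -
                ∫ x, (x.2 i) ^ 2 ∂(μ N T T)) / δ) (𝓝[≠] 0) (𝓝 (t i))) →
            (∀ i : Fin (N + 1), Tendsto (fun δ : ℝ =>
              ((∫ x, (x.2 i) ^ 2 ∂(μ (N + 1) (T + δ / 2) (T - δ / 2))) -
                ∫ x, (x.2 i) ^ 2 ∂(μ (N + 1) T T)) / δ) (𝓝[≠] 0) (𝓝 (t' i))) →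
            ∀ (i j : Fin N) (i' j' : Fin (N + 1)), j.val = i.val + 1 → j'.val = i'.val + 1 →
              (i'.val = i.val →
                |(t i - t j) / (d / ((N : ℝ) - 1)) - (t' i' - t' j') / (d' / (N : ℝ))| ≤
                  C * θ ^ (N - 2 - i.val)) ∧
              (i'.val = i.val + 1 →
                |(t i - t j) / (d / ((N : ℝ) - 1)) - (t' i' - t' j') / (d' / (N : ℝ))| ≤
                  C * θ ^ i.val)) :
    ExponentiallyAffineResistance := by
  intro ω₂ lam β γ hω hl hβ hγ huniq μ hμ T hT D hD
  have ht' := hFP ω₂ lam β γ hω hl hβ hγ huniq μ hμ T hT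
  choose t ht using ht'
  have hpos : ∀ N : ℕ, 2 ≤ N → 0 < D N := hPC ω₂ lam β γ hω hl hβ hγ huniq μ hμ T hT D hD
  obtain ⟨r, θ, C, hθ0, hθ1, hbulk⟩ := hTM ω₂ lam β γ hω hl hβ hγ huniq μ hμ T hT
  have hnb := hNB ω₂ lam β γ hω hl hβ hγ huniq μ hμ T hT D hD
  obtain ⟨θ₂, C₂, hθ₂0, hθ₂1, hdec⟩ := hFCD ω₂ lam β γ hω hl hβ hγ huniq μ hμ T hT
  have hγ0 : γ ≠ 0 := ne_of_gt hγ
  -- per-bond conductance `g N = D_N/(N-1)`, site profile `s N k` (junk `0` off the chain) and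
  -- local bond resistance `ρ N i = (s N i - s N (i+1)) / g N`
  set g : ℕ → ℝ := fun N => D N / ((N : ℝ) - 1) with hg
  have hgpos : ∀ N : ℕ, 2 ≤ N → 0 < g N := by
    intro N hN
    have hN2 : (2 : ℝ) ≤ (N : ℝ) := by exact_mod_cast hN
    exact div_pos (hpos N hN) (by linarith)
  have hgsucc : ∀ N : ℕ, g (N + 1) = D (N + 1) / (N : ℝ) := by
    intro N
    simp only [hg]
    push_cast
    ring_nf
  set s : ℕ → ℕ → ℝ := fun N k => if h : k < N then t N ⟨k, h⟩ else 0 with hs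
  have hsk : ∀ (N k : ℕ) (h : k < N), s N k = t N ⟨k, h⟩ := fun N k h => dif_pos h
  set ρ : ℕ → ℕ → ℝ := fun N i => (s N i - s N (i + 1)) / g N with hρ
  -- common constants
  set θ₀ : ℝ := max θ θ₂ with hθ₀
  set C₀ : ℝ := max (max C C₂) 0 with hC₀
  have hθ₀0 : 0 ≤ θ₀ := le_max_of_le_left hθ0
  have hθ₀1 : θ₀ < 1 := max_lt hθ1 hθ₂1
  have hC₀0 : 0 ≤ C₀ := le_max_right _ _
  have hCC₀ : C ≤ C₀ := (le_max_left _ _).trans (le_max_left _ _)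
  have hC₂C₀ : C₂ ≤ C₀ := (le_max_right _ _).trans (le_max_left _ _)
  have hpow1 : ∀ n : ℕ, θ ^ n ≤ θ₀ ^ n := fun n => pow_le_pow_left₀ hθ0 (le_max_left _ _) n
  have hpow2 : ∀ n : ℕ, θ₂ ^ n ≤ θ₀ ^ n := fun n => pow_le_pow_left₀ hθ₂0 (le_max_right _ _) n
  -- (TM) two-mode inequality for the local resistances
  have hTM' : ∀ N i : ℕ, i + 2 ≤ N → |ρ N i - r| ≤ C₀ * (θ₀ ^ i + θ₀ ^ (N - 2 - i)) := by
    intro N i hi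
    have hN : 2 ≤ N := by omega
    have hgN := hgpos N hN
    have h1 : i < N := by omega
    have h2 : i + 1 < N := by omega
    have hb := hbulk N (D N) (t N) (hD N) (ht N) ⟨i, h1⟩ ⟨i + 1, h2⟩ rfl
    have hρNi : ρ N i = (t N ⟨i, h1⟩ - t N ⟨i + 1, h2⟩) / g N := by
      simp only [hρ, hsk N i h1, hsk N (i + 1) h2]
    have hrew : ρ N i - r = (t N ⟨i, h1⟩ - t N ⟨i + 1, h2⟩ - r * g N) / g N := by
      rw [hρNi]
      field_simp
    rw [hrew, abs_div, abs_of_pos hgN, div_le_iff₀ hgN]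
    calc |t N ⟨i, h1⟩ - t N ⟨i + 1, h2⟩ - r * g N|
        ≤ C * |g N| * (θ ^ i + θ ^ (N - 2 - i)) := hb
      _ ≤ C₀ * |g N| * (θ₀ ^ i + θ₀ ^ (N - 2 - i)) := by
          have hA : 0 ≤ |g N| * (θ ^ i + θ ^ (N - 2 - i)) := by positivity
          calc C * |g N| * (θ ^ i + θ ^ (N - 2 - i)) = C * (|g N| * (θ ^ i + θ ^ (N - 2 - i))) := by
                ring
            _ ≤ C₀ * (|g N| * (θ ^ i + θ ^ (N - 2 - i))) := mul_le_mul_of_nonneg_right hCC₀ hA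
            _ ≤ C₀ * (|g N| * (θ₀ ^ i + θ₀ ^ (N - 2 - i))) := by
                refine mul_le_mul_of_nonneg_left ?_ hC₀0
                exact mul_le_mul_of_nonneg_left (add_le_add (hpow1 _) (hpow1 _)) (abs_nonneg _)
            _ = C₀ * |g N| * (θ₀ ^ i + θ₀ ^ (N - 2 - i)) := by ring
      _ = C₀ * (θ₀ ^ i + θ₀ ^ (N - 2 - i)) * g N := by rw [abs_of_pos hgN]; ring
  -- (FL) / (FR) far-contact decoupling for the local resistances
  have hFL' : ∀ N i : ℕ, i + 2 ≤ N → |ρ N i - ρ (N + 1) i| ≤ C₀ * θ₀ ^ (N - 2 - i) := by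
    intro N i hi
    have h1 : i < N := by omega
    have h2 : i + 1 < N := by omega
    have h1' : i < N + 1 := by omega
    have h2' : i + 1 < N + 1 := by omega
    obtain ⟨hleft, -⟩ := hdec N (D N) (D (N + 1)) (t N) (t (N + 1)) (hD N) (hD (N + 1)) (ht N)
      (ht (N + 1)) ⟨i, h1⟩ ⟨i + 1, h2⟩ ⟨i, h1'⟩ ⟨i + 1, h2'⟩ rfl rfl
    have h := hleft rfl
    have hρ1 : ρ N i = (t N ⟨i, h1⟩ - t N ⟨i + 1, h2⟩) / (D N / ((N : ℝ) - 1)) := by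
      simp only [hρ, hg, hsk N i h1, hsk N (i + 1) h2]
    have hρ2 : ρ (N + 1) i = (t (N + 1) ⟨i, h1'⟩ - t (N + 1) ⟨i + 1, h2'⟩) / (D (N + 1) / (N : ℝ)) := by
      simp only [hρ, hsk (N + 1) i h1', hsk (N + 1) (i + 1) h2', hgsucc N]
    rw [hρ1, hρ2]
    exact h.trans (mul_le_mul (hC₂C₀) (hpow2 _) (pow_nonneg hθ₂0 _) hC₀0)
  have hFR' : ∀ N j : ℕ, j + 2 ≤ N →
      |ρ N (N - 2 - j) - ρ (N + 1) (N - 1 - j)| ≤ C₀ * θ₀ ^ (N - 2 - j) := by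
    intro N j hj
    have h1 : N - 2 - j < N := by omega
    have h2 : N - 1 - j < N := by omega
    have h1' : N - 1 - j < N + 1 := by omega
    have h2' : N - j < N + 1 := by omega
    obtain ⟨-, hright⟩ := hdec N (D N) (D (N + 1)) (t N) (t (N + 1)) (hD N) (hD (N + 1)) (ht N)
      (ht (N + 1)) ⟨N - 2 - j, h1⟩ ⟨N - 1 - j, h2⟩ ⟨N - 1 - j, h1'⟩ ⟨N - j, h2'⟩
      (by simp only; omega) (by simp only; omega)
    have h := hright (by simp only; omega)
    have e1 : N - 2 - j + 1 = N - 1 - j := by omega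
    have e2 : N - 1 - j + 1 = N - j := by omega
    have hρ1 : ρ N (N - 2 - j) =
        (t N ⟨N - 2 - j, h1⟩ - t N ⟨N - 1 - j, h2⟩) / (D N / ((N : ℝ) - 1)) := by
      simp only [hρ, hg, e1, hsk N (N - 2 - j) h1, hsk N (N - 1 - j) h2]
    have hρ2 : ρ (N + 1) (N - 1 - j) =
        (t (N + 1) ⟨N - 1 - j, h1'⟩ - t (N + 1) ⟨N - j, h2'⟩) / (D (N + 1) / (N : ℝ)) := by
      simp only [hρ, e2, hsk (N + 1) (N - 1 - j) h1', hsk (N + 1) (N - j) h2', hgsucc N]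
    rw [hρ1, hρ2]
    exact h.trans (mul_le_mul (hC₂C₀) (hpow2 _) (pow_nonneg hθ₂0 _) hC₀0)
  -- the glue
  obtain ⟨ρinf, C', θ', hθ'0, hθ'1, hglue⟩ := exponentialLedgerGlue hθ₀0 hθ₀1 hTM' hFL' hFR'
  -- the series ledger `(N-1)/D_N - 2/γ = Σ_{i<N-1} ρ N i` (contact rows + telescoping)
  have hledger : ∀ N : ℕ, 2 ≤ N →
      ((N : ℝ) - 1) / D N - 2 / γ = ∑ i ∈ range (N - 1), ρ N i := by
    intro N hN
    have hgN := hgpos N hN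
    have hg0 : g N ≠ 0 := ne_of_gt hgN
    have hD0 : D N ≠ 0 := ne_of_gt (hpos N hN)
    have hN2 : (2 : ℝ) ≤ (N : ℝ) := by exact_mod_cast hN
    have hN0 : (N : ℝ) - 1 ≠ 0 := by
      have : (0 : ℝ) < (N : ℝ) - 1 := by linarith
      exact ne_of_gt this
    have hlt0 : 0 < N := by omega
    have hltL : N - 1 < N := by omega
    obtain ⟨hc0, hcL⟩ := hCI ω₂ lam β γ hω hl hβ hγ huniq μ hμ T hT N (D N) (t N ⟨0, hlt0⟩)
      (t N ⟨N - 1, hltL⟩) ⟨0, hlt0⟩ ⟨N - 1, hltL⟩ hN rfl rfl (hD N) (ht N ⟨0, hlt0⟩)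
      (ht N ⟨N - 1, hltL⟩)
    have htel : ∑ i ∈ range (N - 1), (s N i - s N (i + 1)) = s N 0 - s N (N - 1) :=
      Finset.sum_range_sub' (s N) (N - 1)
    have hsum : ∑ i ∈ range (N - 1), ρ N i = (s N 0 - s N (N - 1)) / g N := by
      simp only [hρ]
      rw [← Finset.sum_div, htel]
    have ht0 : s N 0 = 1 / 2 - D N / ((N : ℝ) - 1) / γ := by
      rw [hsk N 0 hlt0, ← hc0]
      field_simp
      ring
    have htL : s N (N - 1) = D N / ((N : ℝ) - 1) / γ - 1 / 2 := by
      rw [hsk N (N - 1) hltL, ← hcL]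
      field_simp
      ring
    rw [hsum, ht0, htL]
    simp only [hg]
    field_simp
    ring
  -- hence `Σ_{i<N-1} (ρ N i - r) = (N-1)/D_N - 2/γ - (N-1) r`
  have hledger' : ∀ N : ℕ, 2 ≤ N →
      ∑ i ∈ range (N - 1), (ρ N i - r) = ((N : ℝ) - 1) / D N - 2 / γ - ((N : ℝ) - 1) * r := by
    intro N hN
    have hcard : ((range (N - 1)).card : ℝ) = (N : ℝ) - 1 := by
      rw [Finset.card_range, Nat.cast_sub (by omega : 1 ≤ N), Nat.cast_one]
    rw [Finset.sum_sub_distrib, ← hledger N hN, Finset.sum_const, nsmul_eq_mul, hcard]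
  -- `r > 0` by the series-ledger glue (bounded ledger + non-ballistic)
  have hbounded : ∀ N : ℕ, 2 ≤ N →
      |((N : ℝ) - 1) / D N - 2 / γ - ((N : ℝ) - 1) * r| ≤ |ρinf| + |C'| := by
    intro N hN
    have h := hglue N hN
    rw [hledger' N hN] at h
    have hθN : |C'| * θ' ^ N ≤ |C'| :=
      (mul_le_mul_of_nonneg_left (pow_le_one₀ hθ'0 hθ'1.le) (abs_nonneg _)).trans (le_of_eq (mul_one _))
    have hC'le : C' * θ' ^ N ≤ |C'| :=
      (mul_le_mul_of_nonneg_right (le_abs_self C') (pow_nonneg hθ'0 N)).trans hθN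
    calc |((N : ℝ) - 1) / D N - 2 / γ - ((N : ℝ) - 1) * r|
        = |(((N : ℝ) - 1) / D N - 2 / γ - ((N : ℝ) - 1) * r - ρinf) + ρinf| := by ring_nf
      _ ≤ |((N : ℝ) - 1) / D N - 2 / γ - ((N : ℝ) - 1) * r - ρinf| + |ρinf| := abs_add_le _ _
      _ ≤ |C'| + |ρinf| := add_le_add (h.trans hC'le) le_rfl
      _ = |ρinf| + |C'| := add_comm _ _
  obtain ⟨hr, -⟩ := hSL D γ r (|ρinf| + |C'|) hγ hpos hbounded hnb
  refine ⟨r, 2 / γ + ρinf, θ', C', hr, hθ'0, hθ'1, fun N hN => ?_⟩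
  have h := hglue N hN
  rw [hledger' N hN] at h
  have hrepr : ((N : ℝ) - 1) / D N - (((N : ℝ) - 1) * r + (2 / γ + ρinf)) =
      ((N : ℝ) - 1) / D N - 2 / γ - ((N : ℝ) - 1) * r - ρinf := by ring
  rw [hrepr]
  exact h

end Summit.AtomisticToContinuum.FouriersLaw.Theorems
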